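import Summits.Ventures.PercRepro.Night2ThreeTwoTypeSumsEleven

/-!
# PercRepro — **THE `(3, 2)` OBSTRUCTION CELL IS CLOSED FOR `|V| = 11`; THE `(7, 5)` SHADOW ROW MODULO THE RESIDUES Z**
(night-2, gen 26)

The obstruction cell — `|E ∖ G| = 3`, two coloops, a fat non-basis member and a saturated middle target — with
`|V| = 11` satisfies (LI_G): the column bound holds at every target (`dload_missed_le_cap2_three_two`), and the basis
pairs' inequality follows from the TYPE-SPLIT count sums (`basis_pair_fair_of_qSum3`): the covering bases of a target
with two points on the common line `ℓ` lose at most the chord `E(11) = 67/220`, those with one / no point on `ℓ` at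
most `typeConst 1 y` / `typeConst 0 y` (`faceLoss_sum_le_eleven`), and the eleven sums `1 ≤ qSum3` hold
(`one_le_qSum3_eleven`).  The landed uniform sums failed at `(11, 5, (0,4))` and `(11, 6, ·)`.

* `localShadowHall_three_two_five_of_qSum3s`: the cell for `|V| ≥ 11` from type-split bounds and sums;
* **`localShadowHall_three_two_five_eleven`**: (LI_G) in the obstruction cell with `|V| = 11`;
* **`localShadowHall_three_two_five_of_eleven_le`**: the cell for every `|V| ≥ 11`;
* **`shadowHall_seven_five_of_residuesZ`**: `ShadowHall M 7 5 (phiK 7 5)` for every finite matroid modulo `(2, 0)`,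
  `(2, 1)` as in the residues V and the `(3, 2)` obstruction cells with `|V| ≤ 10`.
-/

namespace PercRepro.Shadow

open Finset PerFlat ThmH

variable {α : Type*} [DecidableEq α] {M : Matroid α} [M.Finite]

section Eleven

variable {G : Finset α}

open scoped Classical in
/-- **THE `(3, 2)` OBSTRUCTION CELL FOR `|V| ≥ 11` MODULO THE TYPE-SPLIT COUNT SUMS**: with two thin members missing
`≤ 3` points with distinct hyperplanes, per-type face-loss bounds `E₂`, `E₁`, `E₀` and the arithmetic
`1 ≤ qSum3 (n − y) y i₀ j₀ n E₂ E₁ E₀` for the three basis profiles, (LI_G) holds. -/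
theorem localShadowHall_three_two_five_of_qSum3s (hG : G ∈ flatsQ M (5 + 1)) (hd : (gr M \ G).card = 3)
    (hk : kColoops M G = 2) (hs : ∀ e ∈ gr M, ∀ f ∈ gr M, e ≠ f → rkN M {e, f} = 2)
    (hl : ∀ e ∈ gr M, M.Indep {e}) (h11 : 11 ≤ (G \ coloops M G).card)
    {B₁ B₂ : Finset α} (hthin₁ : B₁ ∈ thinMembers M 5 G) (hthin₂ : B₂ ∈ thinMembers M 5 G)
    (hm₁ : (G \ clF M B₁).card ≤ 3) (hm₂ : (G \ clF M B₂).card ≤ 3) (hne : clF M B₁ ≠ clF M B₂)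
    {E₂ E₁ E₀ : ℚ} (h2 : 0 ≤ E₂) (h1 : 0 ≤ E₁) (h0 : 0 ≤ E₀)
    (hTE2 : ∀ S ⊆ G, ∀ T ∈ coverBases M G S 4, (T ∩ ((clF M B₁ ∩ clF M B₂) \ coloops M G)).card = 2 →
      ∑ w ∈ T, faceLoss M 5 G (coloops M G ∪ T) w ≤ E₂)
    (hTE1 : ∀ S ⊆ G, ∀ T ∈ coverBases M G S 4, (T ∩ ((clF M B₁ ∩ clF M B₂) \ coloops M G)).card = 1 →
      ∑ w ∈ T, faceLoss M 5 G (coloops M G ∪ T) w ≤ E₁)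
    (hTE0 : ∀ S ⊆ G, ∀ T ∈ coverBases M G S 4, (T ∩ ((clF M B₁ ∩ clF M B₂) \ coloops M G)).card = 0 →
      ∑ w ∈ T, faceLoss M 5 G (coloops M G ∪ T) w ≤ E₀)
    (hsums : ∀ i₀ j₀ : ℕ, i₀ ≤ 2 → i₀ + j₀ = 4 →
      j₀ ≤ ((G \ coloops M G) \ ((clF M B₁ ∩ clF M B₂) \ coloops M G)).card →
      1 ≤ qSum3 ((clF M B₁ ∩ clF M B₂) \ coloops M G).card
          ((G \ coloops M G) \ ((clF M B₁ ∩ clF M B₂) \ coloops M G)).card i₀ j₀ (G \ coloops M G).card E₂ E₁ E₀) :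
    LocalShadowHall M 5 G := by
  have hd' : (gr M \ G).card ≤ 5 := by omega
  set ℓ := (clF M B₁ ∩ clF M B₂) \ coloops M G with hℓdef
  obtain ⟨hℓr, hℓ5, hℓ⟩ := exists_common_line hG hd' hk hs h11 hthin₁ hthin₂ hm₁ hm₂ hne
  have hℓV : ℓ ⊆ G \ coloops M G := fun a ha =>
    Finset.mem_sdiff.2 ⟨(mem_membersIn.1 (mem_thinMembers.1 hthin₁).1).2
      (Finset.mem_inter.1 (Finset.mem_sdiff.1 ha).1).1, (Finset.mem_sdiff.1 ha).2⟩
  have hℓcl : ∀ x ∈ G \ coloops M G, x ∈ clF M ℓ → x ∈ ℓ := fun x hx hcl => line_closed_in_V hx hcl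
  apply localShadowHall_three_two_five_of_basisFair hG hd hk hs hl
  intro B hB hnB z hz
  by_cases hl0 : loss M 5 G B z = 0
  · rw [hl0]
    exact mul_nonneg (rhoL_nonneg hG hd' B z)
      (lossIncomeH_nonneg hG hd' (fun S _ => dload_missed_le_cap2_three_two hG hd hk hs hl (fun _ h => h) S) B z)
  · have hB3 : (B \ coloops M G).card + 1 = 4 := by
      have := card_sdiff_coloops_thin_ge hG hd' (by omega : kColoops M G + 4 = 5 + 1) hB
      unfold BigMember at hnB
      omega
    obtain ⟨hi₀, hij⟩ := profile_of_basis hG hd' hk hℓr hB hB3 hz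
    have hj₀y : (profileAt (coloops M G) ℓ (insert z B)).2 ≤ ((G \ coloops M G) \ ℓ).card := by
      simp only [profileAt]
      apply Finset.card_le_card
      apply Finset.sdiff_subset_sdiff _ (Finset.Subset.refl _)
      apply Finset.sdiff_subset_sdiff _ (Finset.Subset.refl _)
      exact Finset.insert_subset (Finset.mem_sdiff.1 hz).1
        ((subset_clF (mem_membersIn.1 (mem_thinMembers.1 hB).1).1).trans (mem_membersIn.1 (mem_thinMembers.1 hB).1).2)
    exact basis_pair_fair_of_qSum3 hG hd hk hs hl h11 (fun B => Iff.rfl) hℓr (by omega) hℓV hℓcl hℓ hB hnB hz hl0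
      h2 h1 h0 hTE2 hTE1 hTE0 (hsums _ _ hi₀ hij hj₀y)

open scoped Classical in
/-- **THE `(3, 2)` OBSTRUCTION CELL WITH `|V| = 11` SATISFIES (LI_G).** -/
theorem localShadowHall_three_two_five_eleven (hG : G ∈ flatsQ M (5 + 1)) (hd : (gr M \ G).card = 3)
    (hk : kColoops M G = 2) (hs : ∀ e ∈ gr M, ∀ f ∈ gr M, e ≠ f → rkN M {e, f} = 2)
    (hl : ∀ e ∈ gr M, M.Indep {e}) (h11 : (G \ coloops M G).card = 11)
    (hsat : ∃ S ∈ shadowAt M (5 + 2) 5 (Uq M (5 + 2) 5) G, 4 + 1 ≤ (S \ coloops M G).card ∧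
      capS M 5 G S < L1 M 5 G S) :
    LocalShadowHall M 5 G := by
  have hd' : (gr M \ G).card ≤ 5 := by omega
  have h11' : 11 ≤ (G \ coloops M G).card := by omega
  obtain ⟨S, hS, hcard, hsat⟩ := hsat
  obtain ⟨B₁, hthin₁, B₂, hthin₂, hm₁, hm₂, hne⟩ := saturated_faces_three_two hG hd hk hs hl hS hcard hsat
  set ℓ := (clF M B₁ ∩ clF M B₂) \ coloops M G with hℓdef
  obtain ⟨hℓr, hℓ5, hℓ⟩ := exists_common_line hG hd' hk hs h11' hthin₁ hthin₂ hm₁ hm₂ hne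
  have hℓV : ℓ ⊆ G \ coloops M G := fun a ha =>
    Finset.mem_sdiff.2 ⟨(mem_membersIn.1 (mem_thinMembers.1 hthin₁).1).2
      (Finset.mem_inter.1 (Finset.mem_sdiff.1 ha).1).1, (Finset.mem_sdiff.1 ha).2⟩
  have hℓcl : ∀ x ∈ G \ coloops M G, x ∈ clF M ℓ → x ∈ ℓ := fun x hx hcl => line_closed_in_V hx hcl
  set y := ((G \ coloops M G) \ ℓ).card with hy
  have hLy : ℓ.card = (G \ coloops M G).card - y := by
    rw [hy, Finset.card_sdiff_of_subset hℓV]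
    have := Finset.card_le_card hℓV
    omega
  -- `|ℓ| ≥ n − 6`, so `y ≤ 6`
  have hℓ6 : (G \ coloops M G).card - 6 ≤ ℓ.card := by
    have hsub : ((G \ coloops M G) \ (G \ clF M B₁)) \ (G \ clF M B₂) ⊆ ℓ := by
      intro a ha
      simp only [Finset.mem_sdiff, not_and, not_not] at ha
      obtain ⟨⟨⟨haG, haK⟩, h1⟩, h2⟩ := ha
      exact Finset.mem_sdiff.2 ⟨Finset.mem_inter.2 ⟨h1 haG, h2 haG⟩, haK⟩
    have hc := Finset.card_le_card hsub
    have e1 := Finset.le_card_sdiff (G \ clF M B₁) (G \ coloops M G)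
    have e2 := Finset.le_card_sdiff (G \ clF M B₂) ((G \ coloops M G) \ (G \ clF M B₁))
    omega
  have hy6 : y ≤ 6 := by omega
  -- `y ≥ 3`: the two missed sets are distinct subsets of `V ∖ ℓ` of size `≥ 2`
  have hy3 : 3 ≤ y := by
    have hπ : ∀ B ∈ thinMembers M 5 G, ℓ ⊆ clF M B → G \ clF M B ⊆ (G \ coloops M G) \ ℓ := by
      intro B hB hℓB a ha
      rw [Finset.mem_sdiff] at ha
      have hK : coloops M G ⊆ B := coloops_subset_of_mem_thinMembers hG hd' hB
      have hBU : B ∈ Uq M (5 + 2) 5 := (mem_membersIn.1 (mem_thinMembers.1 hB).1).1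
      refine Finset.mem_sdiff.2 ⟨Finset.mem_sdiff.2 ⟨ha.1, fun haK => ha.2 (subset_clF hBU (hK haK))⟩,
        fun haℓ => ha.2 (hℓB haℓ)⟩
    have hℓ1 : ℓ ⊆ clF M B₁ := fun a ha => (Finset.mem_inter.1 (Finset.mem_sdiff.1 ha).1).1
    have hℓ2 : ℓ ⊆ clF M B₂ := fun a ha => (Finset.mem_inter.1 (Finset.mem_sdiff.1 ha).1).2
    have hsub : (G \ clF M B₁) ∪ (G \ clF M B₂) ⊆ (G \ coloops M G) \ ℓ :=
      Finset.union_subset (hπ B₁ hthin₁ hℓ1) (hπ B₂ hthin₂ hℓ2)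
    have hc := Finset.card_le_card hsub
    have hm₁2 : 2 ≤ (G \ clF M B₁).card :=
      two_le_card_sdiff_of_not_lay0 hG hd' (mem_thinMembers.1 hthin₁).1 (mem_thinMembers.1 hthin₁).2
    have hm₂2 : 2 ≤ (G \ clF M B₂).card :=
      two_le_card_sdiff_of_not_lay0 hG hd' (mem_thinMembers.1 hthin₂).1 (mem_thinMembers.1 hthin₂).2
    have hneπ : G \ clF M B₁ ≠ G \ clF M B₂ := by
      intro h
      apply hne
      have hH₁ : clF M B₁ ⊆ G := (mem_membersIn.1 (mem_thinMembers.1 hthin₁).1).2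
      have hH₂ : clF M B₂ ⊆ G := (mem_membersIn.1 (mem_thinMembers.1 hthin₂).1).2
      rw [← Finset.sdiff_sdiff_eq_self hH₁, ← Finset.sdiff_sdiff_eq_self hH₂, h]
    have hu := Finset.card_union_add_card_inter (G \ clF M B₁) (G \ clF M B₂)
    have hlt : ((G \ clF M B₁) ∩ (G \ clF M B₂)).card < (G \ clF M B₁).card ∨
        ((G \ clF M B₁) ∩ (G \ clF M B₂)).card < (G \ clF M B₂).card := by
      by_contra hcon
      push Not at hcon
      have e1 : (G \ clF M B₁) ∩ (G \ clF M B₂) = G \ clF M B₁ :=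
        Finset.eq_of_subset_of_card_le Finset.inter_subset_left hcon.1
      have e2 : (G \ clF M B₁) ∩ (G \ clF M B₂) = G \ clF M B₂ :=
        Finset.eq_of_subset_of_card_le Finset.inter_subset_right hcon.2
      exact hneπ (e1.symm.trans e2)
    omega
  have hn7 : 7 ≤ (G \ coloops M G).card := by omega
  -- the per-type bounds
  have hchord : (((G \ coloops M G).card : ℚ) + 56) / (20 * ((G \ coloops M G).card : ℚ)) =
      ((11 : ℚ) + 56) / (20 * 11) := by
    rw [h11]; push_cast; ring
  apply localShadowHall_three_two_five_of_qSum3s hG hd hk hs hl h11' hthin₁ hthin₂ hm₁ hm₂ hne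
    (E₂ := ((11 : ℚ) + 56) / (20 * 11)) (E₁ := typeConst 1 y) (E₀ := typeConst 0 y)
    (by norm_num) (typeConst_nonneg 1 y) (typeConst_nonneg 0 y)
  · intro S _ T hT _
    have := faceLoss_sum_le_three_two hG hd hk hs hl hn7 T hT
    rwa [hchord] at this
  · intro S _ T hT ht
    have := faceLoss_sum_le_eleven hG hd hk hs hl h11 hℓr (by omega) hℓV hℓcl hy3 hy6 hT (by rw [ht])
    rwa [ht] at this
  · intro S _ T hT ht
    have := faceLoss_sum_le_eleven hG hd hk hs hl h11 hℓr (by omega) hℓV hℓcl hy3 hy6 hT (by rw [ht]; norm_num)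
    rwa [ht] at this
  · intro i₀ j₀ hi₀ hij hj₀
    rw [← hℓdef, hLy, ← hy, h11]
    exact one_le_qSum3_eleven y i₀ j₀ hy3 hy6 hi₀ hij hj₀

open scoped Classical in
/-- The cell for every `|V| ≥ 11`. -/
theorem localShadowHall_three_two_five_of_eleven_le (hG : G ∈ flatsQ M (5 + 1)) (hd : (gr M \ G).card = 3)
    (hk : kColoops M G = 2) (hs : ∀ e ∈ gr M, ∀ f ∈ gr M, e ≠ f → rkN M {e, f} = 2)
    (hl : ∀ e ∈ gr M, M.Indep {e}) (h11 : 11 ≤ (G \ coloops M G).card)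
    (hsat : ∃ S ∈ shadowAt M (5 + 2) 5 (Uq M (5 + 2) 5) G, 4 + 1 ≤ (S \ coloops M G).card ∧
      capS M 5 G S < L1 M 5 G S) :
    LocalShadowHall M 5 G := by
  rcases Nat.lt_or_ge (G \ coloops M G).card 12 with h | h
  · exact localShadowHall_three_two_five_eleven hG hd hk hs hl (by omega) hsat
  · exact localShadowHall_three_two_five_twelve hG hd hk hs hl h hsat

end Eleven

section SevenFiveZ

variable {α' : Type} [DecidableEq α']

open scoped Classical in
/-- **THE `(7, 5)` SHADOW ROW FOR EVERY FINITE MATROID MODULO THE RESIDUES Z**: `(2, 0)`, `(2, 1)` as in the residues V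
and, at `(3, 2)`, only the obstruction cells with at most `10` points off the coloops. -/
theorem shadowHall_seven_five_of_residuesZ
    (h20 : ∀ (N : Matroid α') [N.Finite] (G : Finset α'), CellHyp N G →
      (gr N \ G).card = 2 → kColoops N G = 0 → FatMember N G 6 3 →
      (FatBasis N G 6 2 ∨ FatMember N G 6 2) →
      (2 ≤ (fatClosures N 5 G 2).card ∨
        ∃ B ∈ thinMembers N 5 G, 2 < (G \ clF N B).card ∧ (G \ clF N B).card < 5) →
      LocalShadowHall N 5 G)
    (h21 : ∀ (N : Matroid α') [N.Finite] (G : Finset α'), CellHyp N G →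
      (gr N \ G).card = 2 → kColoops N G = 1 → FatMember N G 5 4 →
      (FatBasis N G 5 3 ∨ FatMember N G 5 3) →
      (2 ≤ (fatClosures N 5 G 2).card ∨
        ∃ B ∈ thinMembers N 5 G, 2 < (G \ clF N B).card ∧ (G \ clF N B).card < 7) →
      LocalShadowHall N 5 G)
    (h32 : ∀ (N : Matroid α') [N.Finite] (G : Finset α'), CellHyp N G →
      (gr N \ G).card = 3 → kColoops N G = 2 → FatMember N G 4 2 →
      (∃ S ∈ shadowAt N (5 + 2) 5 (Uq N (5 + 2) 5) G, 4 + 1 ≤ (S \ coloops N G).card ∧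
        capS N 5 G S < L1 N 5 G S) →
      (G \ coloops N G).card ≤ 10 → LocalShadowHall N 5 G)
    (M : Matroid α') [M.Finite] : ShadowHall M 7 5 (phiK 7 5) := by
  apply shadowHall_seven_five_of_residuesY h20 h21
  intro N _ G hcell hd hk hfm hsat h11
  by_cases h10 : (G \ coloops N G).card ≤ 10
  · exact h32 N G hcell hd hk hfm hsat h10
  · push Not at h10
    exact localShadowHall_three_two_five_eleven hcell.2.2.2 hd hk hcell.1 hcell.2.1 (by omega) hsat

end SevenFiveZ

end PercRepro.Shadow
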